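import Summits.AtomisticToContinuum.Crystallization.Theorems.ChargedEnergyGap.Negative.PeriodicFormConverse
import Summits.AtomisticToContinuum.Crystallization.Theorems.PricedLinkCensusTruncatedCensusGapBlocksTruncLJ

/-!
# The ring census gap (class (R) of line `birth`) implies its PERIODIC form

Helper for the stub `stub_ringCensusGap` of the census split `Cruxes/TruncatedCensusGap/Lines/birth.lean`
of the crux `PricedLinkCensus.TruncatedCensusGap` (item stmt-AtomisticToContinuum-14230): the
`R`-twin of the landed `periodicPricing_of_truncatedCensusGap_of_blocks` /
`periodicPricing_of_truncatedCensusGap` (`…TruncatedCensusGapPeriodicPricingOfGap.lean`,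
`…TruncatedCensusGapCruxForms.lean`), converse of the far-periodisation direction
`ringCensusGap_of_periodicRingPricing` (`…TruncatedCensusGapRingCensusGapOfPeriodicRingPricing.lean`).

Write `V_χ r = min 1 (max 0 (4 - 2r)) · V_LJ r`, `e_χ* = ⨅_Q e_χ(Q)`, and call a site
RING-DEFECTIVE (class (R)) when it has exactly twelve bonds in the scale-free bond graph at
tolerance `1/100` and some bond at it has ring number `≠ 4`.

* Block bookkeeping for the (R)-predicate (`R`-twins of `Blocks.isChargeFree_transl`,
  `Blocks.isChargeFree_toP_iff_motif`, `Blocks.isChargeFree_block_iff`,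
  `Blocks.card_charged_block_ge`, `Blocks.charged_blockConfig_eq`): the predicate depends on the
  configuration only through its bond graph, is invariant under re-indexing by an equivalence and
  under the periods of `Q`, and at `lvl3`-deep block points of the `K³`-blocks `blockConfig Q K`
  it agrees with the predicate read in the infinite point set (`ringDefective_block_iff`, from the
  landed `Blocks.neighborSet_block_eq`); hence at least `#deep · #R(Q)` block points are
  ring-defective in the block (`card_ringDefective_block_ge`).
* `periodicRingPricing_of_ringCensusGap` — **the stub implies the periodic (R)-pricing**: if
  `N · e_χ* + κ · #R(y) ≤ E_χ(y)` for all finite injective `y` (the registered statement of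
  `stub_ringCensusGap`), then every periodic `Q` pays `κ` per ring-defective motif site above
  `e_χ*`, `κ · #R(Q) ≤ #F · (e_χ(Q) − e_χ*)`: apply the gap to the blocks, which are `V_χ` trial
  states (`exists_block_energy_le_truncLJ`, landed), and let `K → ∞` (non-deep lattice
  coordinates are `≤ 6 · lvl3 · K²`, `Blocks.card_deep_ge`).

Together with `ringCensusGap_of_periodicRingPricing` this makes `stub_ringCensusGap` EQUIVALENT to
the periodic (R)-pricing — a statement about Blanc–Lewin's periodic universe only (finite-range
periodic crystallization with tetrahedral-frustration pricing for `V_χ`; open, no named fact of the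
tree).  All `[folklore]` bookkeeping.
-/

noncomputable section

namespace Summit.AtomisticToContinuum.Crystallization.Theorems.PricedLinkCensusTruncatedCensusGap

open Literature.MathematicalPhysics.StatisticalMechanics Literature.Geometry.DiscreteGeometry
open Summit.AtomisticToContinuum.Crystallization.Theorems.ChargedEnergyGapNegative
open Summit.AtomisticToContinuum.Crystallization.Theorems.ChargedEnergyGapNegative.Blocks

section RingDefectiveGeneral

variable {ι κ X X' : Type*} [PseudoMetricSpace X] [PseudoMetricSpace X']

/-- The (R)-predicate depends on the configuration only through its bond graph. [folklore] -/
theorem ringDefective_congr {η η' : ℝ} {y : ι → X} {y' : ι → X'}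
    (h : bondGraph η y = bondGraph η' y') (i : ι) :
    (((bondGraph η y).neighborSet i).ncard = 12 ∧
        ∃ j ∈ (bondGraph η y).neighborSet i, ringNumber η y i j ≠ 4) ↔
      (((bondGraph η' y').neighborSet i).ncard = 12 ∧
        ∃ j ∈ (bondGraph η' y').neighborSet i, ringNumber η' y' i j ≠ 4) := by
  rw [ringNumber_congr h, h]

/-- **Re-indexing invariance of the (R)-predicate**: site `i` of `y ∘ e` is ring-defective iff
site `e i` of `y` is (`e : κ ≃ ι`; the bond graph of `y ∘ e` is the pull-back,
`bondGraph_comp_equiv`). [folklore] -/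
theorem ringDefective_comp_equiv_iff (η : ℝ) (y : ι → X) (e : κ ≃ ι) (i : κ) :
    (((bondGraph η (y ∘ e)).neighborSet i).ncard = 12 ∧
        ∃ a ∈ (bondGraph η (y ∘ e)).neighborSet i, ringNumber η (y ∘ e) i a ≠ 4) ↔
      (((bondGraph η y).neighborSet (e i)).ncard = 12 ∧
        ∃ j ∈ (bondGraph η y).neighborSet (e i), ringNumber η y (e i) j ≠ 4) := by
  have hN : ∀ j : κ,
      (bondGraph η (y ∘ e)).neighborSet j = e ⁻¹' (bondGraph η y).neighborSet (e j) := by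
    intro j
    ext k
    rw [SimpleGraph.mem_neighborSet, bondGraph_comp_equiv, SimpleGraph.comap_adj, Set.mem_preimage,
      SimpleGraph.mem_neighborSet]
  have hc : ∀ s : Set ι, (e ⁻¹' s).ncard = s.ncard := fun s =>
    Set.ncard_preimage_of_injective_subset_range e.injective (by simp [e.range_eq_univ])
  have hR : ∀ a : κ, ringNumber η (y ∘ e) i a = ringNumber η y (e i) (e a) := by
    intro a
    rw [ringNumber_def, ringNumber_def, hN, hN, ← Set.preimage_inter, hc]
  rw [hN, hc]
  refine and_congr_right fun _ => ⟨?_, ?_⟩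
  · rintro ⟨a, ha, hne⟩
    exact ⟨e a, ha, by rwa [← hR]⟩
  · rintro ⟨j, hj, hne⟩
    refine ⟨e.symm j, ?_, ?_⟩
    · show e (e.symm j) ∈ (bondGraph η y).neighborSet (e i)
      rwa [e.apply_symm_apply]
    · rwa [hR, e.apply_symm_apply]

end RingDefectiveGeneral

section RingBlocks

variable (Q : PeriodicConfiguration 3) (K : ℕ)

/-- **Translation invariance of the (R)-predicate in `Q`** (`R`-twin of
`Blocks.isChargeFree_transl`). [folklore] -/
theorem ringDefective_transl (η : ℝ) {g : E3} (hg : g ∈ Q.lattice) (p : Q.points) :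
    (((bondGraph η (ptConfig Q)).neighborSet (transl Q hg p)).ncard = 12 ∧
        ∃ q ∈ (bondGraph η (ptConfig Q)).neighborSet (transl Q hg p),
          ringNumber η (ptConfig Q) (transl Q hg p) q ≠ 4) ↔
      (((bondGraph η (ptConfig Q)).neighborSet p).ncard = 12 ∧
        ∃ q ∈ (bondGraph η (ptConfig Q)).neighborSet p, ringNumber η (ptConfig Q) p q ≠ 4) := by
  rw [← ringDefective_comp_equiv_iff η (ptConfig Q) (transl Q hg) p,
    ringDefective_congr (η' := η) (y' := ptConfig Q)
      (by rw [ptConfig_comp_transl, bondGraph_comp_isometry (isometry_add_right g)]) p]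

/-- The (R)-predicate in `Q` is the same at all block points over the same motif point
(`R`-twin of `Blocks.isChargeFree_toP_iff_motif`). [folklore] -/
theorem ringDefective_toP_iff_motif (η : ℝ) (u : BIdx Q K) :
    (((bondGraph η (ptConfig Q)).neighborSet (toP Q K u)).ncard = 12 ∧
        ∃ q ∈ (bondGraph η (ptConfig Q)).neighborSet (toP Q K u),
          ringNumber η (ptConfig Q) (toP Q K u) q ≠ 4) ↔
      (((bondGraph η (ptConfig Q)).neighborSet ⟨u.1.1, Q.mem_points_of_mem_motif u.1.2⟩).ncard = 12 ∧
        ∃ q ∈ (bondGraph η (ptConfig Q)).neighborSet ⟨u.1.1, Q.mem_points_of_mem_motif u.1.2⟩,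
          ringNumber η (ptConfig Q) ⟨u.1.1, Q.mem_points_of_mem_motif u.1.2⟩ q ≠ 4) := by
  have h : toP Q K u = transl Q (latVec_mem Q (coords K u.2))
      ⟨u.1.1, Q.mem_points_of_mem_motif u.1.2⟩ := Subtype.ext rfl
  rw [h, ringDefective_transl]

/-- **Deep block points are ring-defective in the block iff in `Q`** (`lvl3`-deep, `0 ≤ η ≤ 1`;
`R`-twin of `Blocks.isChargeFree_block_iff`, from `Blocks.neighborSet_block_eq` at the point and
at its bond-neighbours, which are `lvl2`-deep). [folklore] -/
theorem ringDefective_block_iff {η : ℝ} (hη0 : 0 ≤ η) (hη1 : η ≤ 1) {u : BIdx Q K}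
    (hu : IsDeep K (lvl3 Q) u.2) :
    (((bondGraph η (bpt Q K)).neighborSet u).ncard = 12 ∧
        ∃ v ∈ (bondGraph η (bpt Q K)).neighborSet u, ringNumber η (bpt Q K) u v ≠ 4) ↔
      (((bondGraph η (ptConfig Q)).neighborSet (toP Q K u)).ncard = 12 ∧
        ∃ q ∈ (bondGraph η (ptConfig Q)).neighborSet (toP Q K u),
          ringNumber η (ptConfig Q) (toP Q K u) q ≠ 4) := by
  have hu2 : IsDeep K (lvl2 Q) u.2 := IsDeep.mono K (Nat.le_add_right _ _) hu
  have hu1 : IsDeep K (lvl1 Q) u.2 := IsDeep.mono K (Nat.le_add_right _ _) hu2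
  -- neighbours of `u` are level-2-deep
  have hN2 : ∀ j ∈ (bondGraph η (bpt Q K)).neighborSet u, IsDeep K (lvl2 Q) j.2 := by
    intro j hj
    rw [SimpleGraph.mem_neighborSet] at hj
    exact isDeep_of_near Q K hu (dist_le_clearance_of_adj_block Q K hη0 hη1 hu1 hj)
  rw [neighborSet_block_eq Q K hη0 hη1 hu2, Set.ncard_image_of_injective _ (toP_injective Q K),
    Set.exists_mem_image]
  refine and_congr_right fun _ => exists_congr fun j => and_congr_right fun hj => ?_
  rw [ringNumber_def, ringNumber_def, neighborSet_block_eq Q K hη0 hη1 hu2,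
    neighborSet_block_eq Q K hη0 hη1 (hN2 j hj), ← Set.image_inter (toP_injective Q K),
    Set.ncard_image_of_injective _ (toP_injective Q K)]

/-- **Counting ring-defective block points**: at least `#(lvl3-deep coordinates) · #R(Q)` block
points are ring-defective in the BLOCK (`R`-twin of `Blocks.card_charged_block_ge`). [folklore] -/
theorem card_ringDefective_block_ge {η : ℝ} (hη0 : 0 ≤ η) (hη1 : η ≤ 1) :
    Nat.card {k : Fin 3 → Fin K // IsDeep K (lvl3 Q) k} *
        Nat.card {x : Q.motif //
          ((bondGraph η (ptConfig Q)).neighborSet ⟨x.1, Q.mem_points_of_mem_motif x.2⟩).ncard = 12 ∧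
            ∃ q ∈ (bondGraph η (ptConfig Q)).neighborSet ⟨x.1, Q.mem_points_of_mem_motif x.2⟩,
              ringNumber η (ptConfig Q) ⟨x.1, Q.mem_points_of_mem_motif x.2⟩ q ≠ 4} ≤
      Nat.card {u : BIdx Q K // ((bondGraph η (bpt Q K)).neighborSet u).ncard = 12 ∧
        ∃ v ∈ (bondGraph η (bpt Q K)).neighborSet u, ringNumber η (bpt Q K) u v ≠ 4} := by
  classical
  let f : {k : Fin 3 → Fin K // IsDeep K (lvl3 Q) k} ×
      {x : Q.motif //
        ((bondGraph η (ptConfig Q)).neighborSet ⟨x.1, Q.mem_points_of_mem_motif x.2⟩).ncard = 12 ∧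
          ∃ q ∈ (bondGraph η (ptConfig Q)).neighborSet ⟨x.1, Q.mem_points_of_mem_motif x.2⟩,
            ringNumber η (ptConfig Q) ⟨x.1, Q.mem_points_of_mem_motif x.2⟩ q ≠ 4} →
      {u : BIdx Q K // ((bondGraph η (bpt Q K)).neighborSet u).ncard = 12 ∧
        ∃ v ∈ (bondGraph η (bpt Q K)).neighborSet u, ringNumber η (bpt Q K) u v ≠ 4} :=
    fun p => ⟨(p.2.1, p.1.1), by
      rw [ringDefective_block_iff Q K hη0 hη1 (u := (p.2.1, p.1.1)) p.1.2,
        ringDefective_toP_iff_motif]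
      exact p.2.2⟩
  have hf : Function.Injective f := by
    rintro ⟨⟨k, hk⟩, ⟨x, hx⟩⟩ ⟨⟨k', hk'⟩, ⟨x', hx'⟩⟩ h
    have h' := congrArg (fun w => w.1) h
    simp only [f] at h'
    obtain ⟨rfl, rfl⟩ := Prod.ext_iff.1 h'
    rfl
  have := Nat.card_le_card_of_injective f hf
  rw [Nat.card_prod] at this
  exact this

/-- The block configuration (indexed by `Fin (#F K³)`) has as many ring-defective sites as the
block indexed by `BIdx` (`R`-twin of `Blocks.charged_blockConfig_eq`). [folklore] -/
theorem nat_card_ringDefective_blockConfig_eq (η : ℝ) :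
    Nat.card {a : Fin (Fintype.card (BIdx Q K)) //
        ((bondGraph η (blockConfig Q K)).neighborSet a).ncard = 12 ∧
          ∃ b ∈ (bondGraph η (blockConfig Q K)).neighborSet a,
            ringNumber η (blockConfig Q K) a b ≠ 4} =
      Nat.card {u : BIdx Q K // ((bondGraph η (bpt Q K)).neighborSet u).ncard = 12 ∧
        ∃ v ∈ (bondGraph η (bpt Q K)).neighborSet u, ringNumber η (bpt Q K) u v ≠ 4} := by
  refine Nat.card_congr ((Fintype.equivFin (BIdx Q K)).symm.subtypeEquiv fun a => ?_)
  rw [blockConfig]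
  exact ringDefective_comp_equiv_iff η (bpt Q K) (Fintype.equivFin (BIdx Q K)).symm a

end RingBlocks

section Endgame

/-- The real-arithmetic endgame shared with `Blocks.periodicPricing_of_noBoundary`: a block of
side `K` that is a trial state up to `δ/3`, loses at most `6·L·K²` non-deep coordinates and
carries `m` defective motif sites per deep coordinate cannot satisfy the gap if the pricing fails
by `δ > 0` and `K` is large. [folklore] -/
theorem block_pricing_endgame {κ F K L m n D E e eQ δ : ℝ} (hκ : 0 ≤ κ) (hF : 0 < F)
    (hK : 0 < K) (hm : 0 ≤ m) (hδ : δ = κ * m - F * (eQ - e)) (hδ0 : 0 < δ)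
    (hgap : F * K ^ 3 * e + κ * n ≤ E) (hE : E ≤ F * K ^ 3 * (eQ + δ / (3 * F)))
    (hdeep : K ^ 3 ≤ D + 6 * L * K ^ 2) (hch : D * m ≤ n) (hK1 : 18 * L * κ * m / δ < K) :
    False := by
  -- defective block points: at least `(K³ − 6·L·K²)·m`
  have hchR : (K ^ 3 - 6 * L * K ^ 2) * m ≤ n := by nlinarith
  -- `6·L·κ·m·K² ≤ (δ/3)·K³`
  have hsmall : 6 * L * κ * m * K ^ 2 ≤ δ / 3 * K ^ 3 := by
    rw [div_lt_iff₀ hδ0] at hK1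
    have hK2 : (0 : ℝ) ≤ K ^ 2 := by positivity
    nlinarith
  have hmono : κ * ((K ^ 3 - 6 * L * K ^ 2) * m) ≤ κ * n := mul_le_mul_of_nonneg_left hchR hκ
  have hK3 : (0 : ℝ) < K ^ 3 := by positivity
  have hE' : E ≤ F * K ^ 3 * eQ + K ^ 3 * (δ / 3) := by
    have : F * K ^ 3 * (δ / (3 * F)) = K ^ 3 * (δ / 3) := by field_simp
    nlinarith
  have key : K ^ 3 * (κ * m - δ / 3) ≤ K ^ 3 * (F * (eQ - e) + δ / 3) := by nlinarith
  have := le_of_mul_le_mul_left key hK3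
  rw [hδ] at this
  linarith

end Endgame

/-- **The ring census gap implies the periodic (R)-pricing for `V_χ`** (with the same `κ`).
If `N · e_χ* + κ · #R(y) ≤ E_χ(y)` for every finite injective configuration `y` of `ℝ³` (the
registered statement of `stub_ringCensusGap`), then every periodic configuration `Q` pays `κ`
per ring-defective motif site (twelve bonds and a bond of ring number `≠ 4` in the scale-free bond
graph of `Q.points` at tolerance `1/100`) above `e_χ*`: `κ · #R(Q) ≤ #motif · (e_χ(Q) − e_χ*)`.
Blocks are `V_χ` trial states (`exists_block_energy_le_truncLJ`); deep block points are
ring-defective in the block iff their motif point is so in `Q`. [folklore] -/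
theorem periodicRingPricing_of_ringCensusGap : (∃ κ : ℝ, 0 < κ ∧ ∀ (N : ℕ) (y : Fin N → EuclideanSpace ℝ (Fin 3)), Function.Injective y → (N : ℝ) * (⨅ Q : Literature.MathematicalPhysics.StatisticalMechanics.PeriodicConfiguration 3, Q.energyPerParticle (fun r => min 1 (max 0 (4 - 2 * r)) * Literature.MathematicalPhysics.StatisticalMechanics.lennardJones r)) + κ * (Nat.card {i : Fin N // ((Literature.Geometry.DiscreteGeometry.bondGraph (1 / 100 : ℝ) y).neighborSet i).ncard = 12 ∧ ∃ j ∈ (Literature.Geometry.DiscreteGeometry.bondGraph (1 / 100 : ℝ) y).neighborSet i, Literature.Geometry.DiscreteGeometry.ringNumber (1 / 100 : ℝ) y i j ≠ 4} : ℝ) ≤ Literature.MathematicalPhysics.StatisticalMechanics.interactionEnergy (fun r => min 1 (max 0 (4 - 2 * r)) * Literature.MathematicalPhysics.StatisticalMechanics.lennardJones r) y) → ∃ κ : ℝ, 0 < κ ∧ ∀ Q : Literature.MathematicalPhysics.StatisticalMechanics.PeriodicConfiguration 3, κ * (Nat.card {x : Q.motif // ((Literature.Geometry.DiscreteGeometry.bondGraph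 (1 / 100 : ℝ) (Subtype.val : Q.points → EuclideanSpace ℝ (Fin 3))).neighborSet ⟨x.1, Q.mem_points_of_mem_motif x.2⟩).ncard = 12 ∧ ∃ q ∈ (Literature.Geometry.DiscreteGeometry.bondGraph (1 / 100 : ℝ) (Subtype.val : Q.points → EuclideanSpace ℝ (Fin 3))).neighborSet ⟨x.1, Q.mem_points_of_mem_motif x.2⟩, Literature.Geometry.DiscreteGeometry.ringNumber (1 / 100 : ℝ) (Subtype.val : Q.points → EuclideanSpace ℝ (Fin 3)) ⟨x.1, Q.mem_points_of_mem_motif x.2⟩ q ≠ 4} : ℝ) ≤ (Q.motif.card : ℝ) * (Q.energyPerParticle (fun r => min 1 (max 0 (4 - 2 * r)) * Literature.MathematicalPhysics.StatisticalMechanics.lennardJones r) - ⨅ Q' : Literature.MathematicalPhysics.StatisticalMechanics.PeriodicConfiguration 3, Q'.energyPerParticle (fun r => min 1 (max 0 (4 - 2 * r)) * Literature.MathematicalPhysics.StatisticalMechanics.lennardJones r)) := by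
  rintro ⟨κ, hκ, hgap⟩
  refine ⟨κ, hκ, fun Q => ?_⟩
  by_contra hlt
  rw [not_le] at hlt
  have hF : (0 : ℝ) < Q.motif.card := by exact_mod_cast Q.motif_nonempty.card_pos
  -- name the potential, the periodic infimum and the (R)-count of the motif
  set V : ℝ → ℝ := fun r => min 1 (max 0 (4 - 2 * r)) * lennardJones r with hV
  set e : ℝ := ⨅ Q' : PeriodicConfiguration 3, Q'.energyPerParticle V with he
  obtain ⟨mR, hmR⟩ : ∃ mR : ℕ, mR = Nat.card {x : Q.motif //
      ((bondGraph (1 / 100 : ℝ) (ptConfig Q)).neighborSet ⟨x.1, Q.mem_points_of_mem_motif x.2⟩).ncard = 12 ∧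
        ∃ q ∈ (bondGraph (1 / 100 : ℝ) (ptConfig Q)).neighborSet ⟨x.1, Q.mem_points_of_mem_motif x.2⟩,
          ringNumber (1 / 100 : ℝ) (ptConfig Q) ⟨x.1, Q.mem_points_of_mem_motif x.2⟩ q ≠ 4} :=
    ⟨_, rfl⟩
  have hlt' : (Q.motif.card : ℝ) * (Q.energyPerParticle V - e) < κ * (mR : ℝ) := by
    rw [hmR]; exact hlt
  clear hlt
  have hm : (0 : ℝ) ≤ mR := Nat.cast_nonneg _
  set δ : ℝ := κ * (mR : ℝ) - (Q.motif.card : ℝ) * (Q.energyPerParticle V - e) with hδ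
  have hδ0 : 0 < δ := by rw [hδ]; linarith
  -- blocks are trial states with slack `δ / (3 #F)` per particle (landed for `V_χ`)
  obtain ⟨K₀, hK₀, hK⟩ := exists_block_energy_le_truncLJ Q (δ / (3 * Q.motif.card)) (by positivity)
  -- a large `K`: beyond `K₀` and with `18·lvl3·κ·mR / δ < K`
  obtain ⟨K₁, hK₁⟩ := exists_nat_gt (18 * (lvl3 Q : ℝ) * κ * mR / δ)
  set K := max K₀ (K₁ + 1) with hKdef
  have hKK₀ : K₀ ≤ K := le_max_left _ _
  have hKK₁ : K₁ + 1 ≤ K := le_max_right _ _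
  have hKpos : (0 : ℝ) < K := by exact_mod_cast lt_of_lt_of_le hK₀ hKK₀
  have hK1r : 18 * (lvl3 Q : ℝ) * κ * mR / δ < K := by
    have : (K₁ : ℝ) + 1 ≤ K := by exact_mod_cast hKK₁
    linarith
  -- the gap on the block (the hypothesis, specialised), counted over `BIdx`
  have hgapK := hgap _ (blockConfig Q K) (blockConfig_injective Q K)
  rw [nat_card_ringDefective_blockConfig_eq] at hgapK
  have hn : ((Fintype.card (BIdx Q K) : ℕ) : ℝ) = Q.motif.card * (K : ℝ) ^ 3 := by
    exact_mod_cast card_BIdx Q K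
  rw [hn] at hgapK
  have hE := hK K hKK₀
  rw [hn] at hE
  -- ring-defective block points: at least `#deep · mR`; deep coordinates: at least `K³ − 6·lvl3·K²`
  have hch := card_ringDefective_block_ge Q K (η := 1 / 100) (by norm_num) (by norm_num)
  rw [← hmR] at hch
  have hchr := (Nat.cast_le (α := ℝ)).2 hch
  push_cast at hchr
  have hdeep := (Nat.cast_le (α := ℝ)).2 (card_deep_ge K (lvl3 Q))
  push_cast at hdeep
  exact block_pricing_endgame hκ.le hF hKpos hm hδ hδ0 hgapK hE hdeep hchr hK1r

end Summit.AtomisticToContinuum.Crystallization.Theorems.PricedLinkCensusTruncatedCensusGap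

end
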